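import Summits.Ventures.PercRepro.S1CoreCapSum
import Summits.Ventures.PercRepro.CoLoopDecomp
import Summits.Ventures.PercRepro.RankLevelSetPlaneTen

/-!
# PercRepro — the averaging recursion for `s₄` at nullity `≥ 7`: `s₄ ≤ 73 / 105 / 147` at `ν = 7 / 8 / 9` (p1, gen 22)

`proofs/P1-S4-CAPBRIDGE.md` §10 (p2's LEMMA-Q averaging, 8454, applied to 4-circuits). DOUBLE COUNT: over the points
of the ground set the 4-circuits through a point sum to `4·s₄` (`sum_ncard_fourCircuitsThrough_eq`); coloops lie on
no circuit, so some NON-coloop `x` lies on at most `⌊4·s₄/m⌋` four-circuits, `m` the number of non-coloops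
(`exists_nonColoop_ncard_fourCircuitsThrough_le`). On a core of nullity `d + 1 ≥ 7`, `m ≥ d + 6`
(`card_nonColoops_ge`: `r(E) = r(E ∖ K) + |K|` for the coloops `K` — p3's `CoLoopDecomp.eRk_union_subset_coloops` —
so `|E ∖ K| = r(E ∖ K) + d + 1`, and `r(E ∖ K) ≤ 4` would give `≤ 10` points (rank-4 sets of the core), hence
`r ≤ 3`, `≤ 6` points (planes), hence `d + 1 ≤ 5`). Deleting `x` (`S1CoreSplit`: `s₄(M) ≤ #4circ(x) + s₄(M ＼ {x})`,
`M ＼ {x}` a core of nullity `d`) gives THE RECURSION `s₄(d+1) − ⌊4·s₄(d+1)/(d + 6)⌋ ≤ s₄(d)`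
(`ncard_fourCircuits_sub_div_le`). From `s₄(6) ≤ 49` (S1CoreCapSum, modulo `Q*(3..5)`): `s₄(7) ≤ 73`,
`s₄(8) ≤ 105`, `s₄(9) ≤ 147`, and in general `s₄ ≤ avgBound k` at nullity `k + 6` with
`avgBound (k+1) = ⌊(k+12)·avgBound k/(k+8)⌋` (`49, 73, 105, 147, 200, 266, 347, …, 3445` at nullity 24) — modulo exactly
the three computed instances `FourCapSpec capPaper 3 5 / 4 8 / 5 11`; below `fourCircuitBound` (T4⁺) up to nullity 28.
Axioms: standard.
-/

open scoped Matroid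

namespace PercRepro

namespace S1

open Set

open FourCap

variable {α : Type}

open Classical in
/-- **Double count**: over the points of the ground set, the 4-circuits through a point sum to `4 · s₄`. -/
theorem sum_ncard_fourCircuitsThrough_eq (M : Matroid α) [M.Finite] :
    ∑ x ∈ M.ground_finite.toFinset, {C : Set α | M.IsCircuit C ∧ C.ncard = 4 ∧ x ∈ C}.ncard =
      4 * {C : Set α | M.IsCircuit C ∧ C.ncard = 4}.ncard := by
  have hS : {C : Set α | M.IsCircuit C ∧ C.ncard = 4}.Finite :=
    M.ground_finite.finite_subsets.subset (fun C hC => hC.1.subset_ground)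
  set Sf := hS.toFinset with hSf
  have h1 : ∀ x, {C : Set α | M.IsCircuit C ∧ C.ncard = 4 ∧ x ∈ C}.ncard = (Sf.filter (fun C => x ∈ C)).card := by
    intro x
    rw [← ncard_coe_finset]
    congr 1
    ext C
    simp only [Finset.coe_filter, hSf, Set.Finite.mem_toFinset, mem_setOf_eq]
    tauto
  have h2 : ∀ C ∈ Sf, (M.ground_finite.toFinset.filter (fun x => x ∈ C)).card = 4 := by
    intro C hC
    rw [hSf, Set.Finite.mem_toFinset] at hC
    have : (M.ground_finite.toFinset.filter (fun x => x ∈ C) : Set α) = C := by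
      ext x
      simp only [Finset.coe_filter, Set.Finite.mem_toFinset, mem_setOf_eq]
      exact ⟨fun h => h.2, fun h => ⟨hC.1.subset_ground h, h⟩⟩
    rw [← ncard_coe_finset, this, hC.2]
  calc ∑ x ∈ M.ground_finite.toFinset, {C : Set α | M.IsCircuit C ∧ C.ncard = 4 ∧ x ∈ C}.ncard
      = ∑ x ∈ M.ground_finite.toFinset, ∑ C ∈ Sf, (if x ∈ C then 1 else 0) := by
        refine Finset.sum_congr rfl (fun x _ => ?_); rw [h1 x, Finset.card_filter]
    _ = ∑ C ∈ Sf, ∑ x ∈ M.ground_finite.toFinset, (if x ∈ C then 1 else 0) := Finset.sum_comm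
    _ = ∑ C ∈ Sf, 4 := by
        refine Finset.sum_congr rfl (fun C hC => ?_); rw [← Finset.card_filter, h2 C hC]
    _ = 4 * {C : Set α | M.IsCircuit C ∧ C.ncard = 4}.ncard := by
        rw [Finset.sum_const, smul_eq_mul, mul_comm, hSf, ← ncard_eq_toFinset_card _ hS]

/-- A coloop lies on no 4-circuit. -/
theorem ncard_fourCircuitsThrough_eq_zero_of_isColoop (M : Matroid α) {x : α} (hx : M.IsColoop x) :
    {C : Set α | M.IsCircuit C ∧ C.ncard = 4 ∧ x ∈ C}.ncard = 0 := by
  have : {C : Set α | M.IsCircuit C ∧ C.ncard = 4 ∧ x ∈ C} = ∅ := by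
    ext C; simp only [mem_setOf_eq, mem_empty_iff_false, iff_false]
    rintro ⟨hC, _, hxC⟩
    exact hC.not_isColoop_of_mem hxC hx
  rw [this, ncard_empty]

open Classical in
/-- **Averaging**: if `s₄ > 0`, some non-coloop `x` lies on at most `⌊4·s₄ / m⌋` four-circuits, where `m` is the
number of non-coloops. -/
theorem exists_nonColoop_ncard_fourCircuitsThrough_le (M : Matroid α) [M.Finite]
    (hpos : 0 < {C : Set α | M.IsCircuit C ∧ C.ncard = 4}.ncard) :
    ∃ x ∈ M.E, ¬ M.IsColoop x ∧ {C : Set α | M.IsCircuit C ∧ C.ncard = 4 ∧ x ∈ C}.ncard ≤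
      4 * {C : Set α | M.IsCircuit C ∧ C.ncard = 4}.ncard /
        (M.ground_finite.toFinset.filter (fun x => ¬ M.IsColoop x)).card := by
  have hS : {C : Set α | M.IsCircuit C ∧ C.ncard = 4}.Finite :=
    M.ground_finite.finite_subsets.subset (fun C hC => hC.1.subset_ground)
  have hsum : ∑ x ∈ M.ground_finite.toFinset.filter (fun x => ¬ M.IsColoop x),
      {C : Set α | M.IsCircuit C ∧ C.ncard = 4 ∧ x ∈ C}.ncard = 4 * {C : Set α | M.IsCircuit C ∧ C.ncard = 4}.ncard := by
    rw [Finset.sum_filter_of_ne]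
    · exact sum_ncard_fourCircuitsThrough_eq M
    · intro x _ hfx hcol
      exact hfx (ncard_fourCircuitsThrough_eq_zero_of_isColoop M hcol)
  -- the non-coloops are nonempty: a point of a 4-circuit
  have hm : 0 < (M.ground_finite.toFinset.filter (fun x => ¬ M.IsColoop x)).card := by
    obtain ⟨C₀, hC₀⟩ := (ncard_pos hS).1 hpos
    obtain ⟨x₀, hx₀⟩ := hC₀.1.nonempty
    refine Finset.card_pos.2 ⟨x₀, ?_⟩
    rw [Finset.mem_filter, Set.Finite.mem_toFinset]
    exact ⟨hC₀.1.subset_ground hx₀, hC₀.1.not_isColoop_of_mem hx₀⟩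
  by_contra hno
  push Not at hno
  have hall : ∀ x ∈ M.ground_finite.toFinset.filter (fun x => ¬ M.IsColoop x),
      4 * {C : Set α | M.IsCircuit C ∧ C.ncard = 4}.ncard /
        (M.ground_finite.toFinset.filter (fun x => ¬ M.IsColoop x)).card + 1 ≤
        {C : Set α | M.IsCircuit C ∧ C.ncard = 4 ∧ x ∈ C}.ncard := by
    intro x hx
    have hx' := hx
    rw [Finset.mem_filter, Set.Finite.mem_toFinset] at hx'
    have := hno x hx'.1 hx'.2
    omega
  have hge := Finset.card_nsmul_le_sum _ _ _ hall
  rw [smul_eq_mul, hsum] at hge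
  have hdm := Nat.div_add_mod (4 * {C : Set α | M.IsCircuit C ∧ C.ncard = 4}.ncard)
    (M.ground_finite.toFinset.filter (fun x => ¬ M.IsColoop x)).card
  have hmod := Nat.mod_lt (4 * {C : Set α | M.IsCircuit C ∧ C.ncard = 4}.ncard) hm
  have hmul : (M.ground_finite.toFinset.filter (fun x => ¬ M.IsColoop x)).card *
      (4 * {C : Set α | M.IsCircuit C ∧ C.ncard = 4}.ncard /
        (M.ground_finite.toFinset.filter (fun x => ¬ M.IsColoop x)).card + 1) =
      (M.ground_finite.toFinset.filter (fun x => ¬ M.IsColoop x)).card *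
      (4 * {C : Set α | M.IsCircuit C ∧ C.ncard = 4}.ncard /
        (M.ground_finite.toFinset.filter (fun x => ¬ M.IsColoop x)).card) +
      (M.ground_finite.toFinset.filter (fun x => ¬ M.IsColoop x)).card := by ring
  omega

/-- **The non-coloops of a core of nullity `d + 1 ≥ 7` number at least `d + 6`**: with `K` the coloops and
`E' = E ∖ K`, `r(E) = r(E') + |K|` (p3's `eRk_union_subset_coloops`), so `|E'| = r(E') + d + 1`; `r(E') ≤ 4` would
give `|E'| ≤ 10` (rank-4 sets of the core), hence `r(E') ≤ 3` and `|E'| ≤ 6` (planes), hence `d + 1 ≤ 5`. -/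
theorem card_nonColoops_ge (M : Matroid α) [M.Finite]
    (hfree : ∀ e ∈ M.E, ∃ A ⊆ M.E \ {e}, e ∉ M.closure A ∧ e ∉ M.closure ((M.E \ {e}) \ A))
    {d : ℕ} (hd : M.E.encard = M.eRank + (d + 1)) (hd6 : 6 ≤ d) :
    d + 6 ≤ (M.E \ M.coloops).ncard := by
  have hK : M.coloops ⊆ M.E := M.coloops_subset_ground
  have hE' : M.E \ M.coloops ⊆ M.E := sdiff_subset
  have hunion : (M.E \ M.coloops) ∪ M.coloops = M.E := sdiff_union_of_subset hK
  have hr := PercRepro.eRk_union_subset_coloops (M := M) hE' subset_rfl disjoint_sdiff_left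
  rw [hunion, ← _root_.Matroid.eRank_def] at hr
  have hcard := ncard_sdiff_add_ncard_of_subset hK M.ground_finite
  -- everything is finite: pass to ℕ
  have hKfin : M.coloops.Finite := M.ground_finite.subset hK
  have hrE' : M.eRk (M.E \ M.coloops) ≠ ⊤ :=
    ne_top_of_le_ne_top (M.ground_finite.subset hE').encard_lt_top.ne (M.eRk_le_encard _)
  obtain ⟨r', hr'⟩ := ENat.ne_top_iff_exists.1 hrE'
  obtain ⟨R, hR⟩ := ENat.ne_top_iff_exists.1 (PercRepro.Matroid.eRank_ne_top_of_finite M)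
  have hRk : R = r' + M.coloops.ncard := by
    have := hr
    rw [← hR, ← hr', ← Set.Finite.cast_ncard_eq hKfin] at this
    exact_mod_cast this
  have hEn : M.E.ncard = R + (d + 1) := by
    have := hd
    rw [← hR, ← Set.Finite.cast_ncard_eq M.ground_finite] at this
    exact_mod_cast this
  have hE'n : (M.E \ M.coloops).ncard = r' + (d + 1) := by omega
  -- r' ≥ 5 by the core's point bounds
  by_contra hlt
  push Not at hlt
  have hr'4 : r' ≤ 4 := by omega
  have h10 := ThmN.ncard_le_ten_of_eRk_le_four_of_free M hfree hE' (by rw [← hr']; exact_mod_cast hr'4)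
  have hr'3 : r' ≤ 3 := by omega
  have h6 := ThmN.ncard_le_six_of_eRk_le_three_of_free M hfree hE' (by rw [← hr']; exact_mod_cast hr'3)
  omega

open Classical in
/-- **The averaging recursion**: on a core of nullity `d + 1` with `d ≥ 6`, if every core of nullity `d` has
`s₄ ≤ B`, then `s₄ − ⌊4·s₄/(d + 6)⌋ ≤ B`. -/
theorem ncard_fourCircuits_sub_div_le (M : Matroid α) [M.Finite]
    (hfree : ∀ e ∈ M.E, ∃ A ⊆ M.E \ {e}, e ∉ M.closure A ∧ e ∉ M.closure ((M.E \ {e}) \ A))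
    {d : ℕ} (hd : M.E.encard = M.eRank + (d + 1)) (hd6 : 6 ≤ d) {B : ℕ}
    (hB : ∀ (M' : Matroid α) [M'.Finite],
      (∀ e ∈ M'.E, ∃ A ⊆ M'.E \ {e}, e ∉ M'.closure A ∧ e ∉ M'.closure ((M'.E \ {e}) \ A)) →
      M'.E.encard = M'.eRank + d → {C : Set α | M'.IsCircuit C ∧ C.ncard = 4}.ncard ≤ B) :
    {C : Set α | M.IsCircuit C ∧ C.ncard = 4}.ncard -
      4 * {C : Set α | M.IsCircuit C ∧ C.ncard = 4}.ncard / (d + 6) ≤ B := by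
  rcases Nat.eq_zero_or_pos {C : Set α | M.IsCircuit C ∧ C.ncard = 4}.ncard with h0 | hpos
  · rw [h0]; simp
  obtain ⟨x, hxE, hxc, hx⟩ := exists_nonColoop_ncard_fourCircuitsThrough_le M hpos
  -- the non-coloops number at least `d + 6`
  have hm : d + 6 ≤ (M.ground_finite.toFinset.filter (fun x => ¬ M.IsColoop x)).card := by
    have : (M.ground_finite.toFinset.filter (fun x => ¬ M.IsColoop x) : Set α) = M.E \ M.coloops := by
      ext y; simp only [Finset.coe_filter, Set.Finite.mem_toFinset, mem_setOf_eq, mem_sdiff,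
        Matroid.isColoop_iff_mem_coloops]
    rw [← ncard_coe_finset, this]
    exact card_nonColoops_ge M hfree hd hd6
  have hx' : {C : Set α | M.IsCircuit C ∧ C.ncard = 4 ∧ x ∈ C}.ncard ≤
      4 * {C : Set α | M.IsCircuit C ∧ C.ncard = 4}.ncard / (d + 6) :=
    hx.trans (Nat.div_le_div_left hm (by omega))
  -- `M ＼ {x}` is a core of nullity `d`
  have hν : M✶.eRank = ((d + 1 : ℕ) : ℕ∞) := by
    have h := _root_.Matroid.eRank_add_eRank_dual M
    rw [hd] at h
    exact WithTop.add_left_cancel (PercRepro.Matroid.eRank_ne_top_of_finite M) h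
  have hdel := PercRepro.Matroid.dual_eRank_delete_singleton_add_one hxE hxc
  rw [hν] at hdel
  have hfin' : (M ＼ {x})✶.eRank ≠ ⊤ := by
    intro h
    rw [h] at hdel
    have h2 : ((d + 1 : ℕ) : ℕ∞) = ⊤ := by rw [← hdel]; simp
    exact ENat.coe_ne_top _ h2
  obtain ⟨d', hd'⟩ := ENat.ne_top_iff_exists.1 hfin'
  have hdd' : d = d' := by
    rw [← hd'] at hdel
    have : d' + 1 = d + 1 := by exact_mod_cast hdel
    omega
  subst hdd'
  have hd'enc : (M ＼ {x}).E.encard = (M ＼ {x}).eRank + d := by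
    have h := _root_.Matroid.eRank_add_eRank_dual (M ＼ {x})
    rw [← hd'] at h
    exact h.symm
  have hB' := hB (M ＼ {x}) (hfree_delete M hfree x) hd'enc
  have hsplit := ncard_fourCircuits_le_through_add_delete M x
  omega

/-- **`s₄ ≤ 73` on every core of nullity 7** — modulo exactly `Q*(3) = 5`, `Q*(4) = 8`, `Q*(5) = 11`: the averaging
recursion on `s₄(6) ≤ 49` with `|E'| ≥ 12`: `s − ⌊s/3⌋ ≤ 49 ⟹ s ≤ 73`. -/
theorem ncard_fourCircuits_le_seventy_three (M : Matroid α) [M.Finite]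
    (hfree : ∀ e ∈ M.E, ∃ A ⊆ M.E \ {e}, e ∉ M.closure A ∧ e ∉ M.closure ((M.E \ {e}) \ A))
    (hd : M.E.encard = M.eRank + 7) (hQ3 : FourCapSpec capPaper 3 5) (hQ4 : FourCapSpec capPaper 4 8)
    (hQ5 : FourCapSpec capPaper 5 11) : {C : Set α | M.IsCircuit C ∧ C.ncard = 4}.ncard ≤ 73 := by
  have h := ncard_fourCircuits_sub_div_le M hfree (d := 6) hd (le_refl 6)
    (fun M' _ hfree' hd' => ncard_fourCircuits_le_forty_nine M' hfree' hd' hQ3 hQ4 hQ5)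
  omega

/-- **`s₄ ≤ 105` on every core of nullity 8** — modulo the same three instances (`s − ⌊4s/13⌋ ≤ 73`). -/
theorem ncard_fourCircuits_le_one_hundred_five (M : Matroid α) [M.Finite]
    (hfree : ∀ e ∈ M.E, ∃ A ⊆ M.E \ {e}, e ∉ M.closure A ∧ e ∉ M.closure ((M.E \ {e}) \ A))
    (hd : M.E.encard = M.eRank + 8) (hQ3 : FourCapSpec capPaper 3 5) (hQ4 : FourCapSpec capPaper 4 8)
    (hQ5 : FourCapSpec capPaper 5 11) : {C : Set α | M.IsCircuit C ∧ C.ncard = 4}.ncard ≤ 105 := by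
  have h := ncard_fourCircuits_sub_div_le M hfree (d := 7) hd (by norm_num)
    (fun M' _ hfree' hd' => ncard_fourCircuits_le_seventy_three M' hfree' hd' hQ3 hQ4 hQ5)
  omega

/-- **`s₄ ≤ 147` on every core of nullity 9** — modulo the same three instances (`s − ⌊4s/14⌋ ≤ 105`). -/
theorem ncard_fourCircuits_le_one_hundred_forty_seven (M : Matroid α) [M.Finite]
    (hfree : ∀ e ∈ M.E, ∃ A ⊆ M.E \ {e}, e ∉ M.closure A ∧ e ∉ M.closure ((M.E \ {e}) \ A))
    (hd : M.E.encard = M.eRank + 9) (hQ3 : FourCapSpec capPaper 3 5) (hQ4 : FourCapSpec capPaper 4 8)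
    (hQ5 : FourCapSpec capPaper 5 11) : {C : Set α | M.IsCircuit C ∧ C.ncard = 4}.ncard ≤ 147 := by
  have h := ncard_fourCircuits_sub_div_le M hfree (d := 8) hd (by norm_num)
    (fun M' _ hfree' hd' => ncard_fourCircuits_le_one_hundred_five M' hfree' hd' hQ3 hQ4 hQ5)
  omega

/-- `s − ⌊4s/m⌋ ≤ B` with `m > 4` gives `s ≤ ⌊m·B/(m − 4)⌋` (`(m − 4)·s ≤ m·B`). -/
theorem le_mul_div_of_sub_div_le {s B m : ℕ} (hm : 4 < m) (h : s - 4 * s / m ≤ B) : s ≤ m * B / (m - 4) := by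
  have h1 : s ≤ B + 4 * s / m := by omega
  have h2 : m * (4 * s / m) ≤ 4 * s := Nat.mul_div_le (4 * s) m
  have h3 : m * s ≤ m * B + 4 * s := by nlinarith [Nat.mul_le_mul_left m h1]
  have h4 : (m - 4) * s ≤ m * B := by
    have : (m - 4) * s + 4 * s = m * s := by rw [← Nat.add_mul, Nat.sub_add_cancel hm.le]
    omega
  exact (Nat.le_div_iff_mul_le (by omega)).2 (by rw [mul_comm]; exact h4)

/-- **The averaging table**: `avgBound k` bounds `s₄` at nullity `k + 6` — `49` at `k = 0`, then
`avgBound (k + 1) = ⌊(k + 12) · avgBound k / (k + 8)⌋`: `49, 73, 105, 147, 200, 266, 347, 446, 564, 705, 870, …`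
(`3445` at nullity 24, `5933` at 28; below `fourCircuitBound` up to nullity 28). -/
def avgBound : ℕ → ℕ
  | 0 => 49
  | k + 1 => (k + 12) * avgBound k / (k + 8)

/-- **`s₄ ≤ avgBound k` on every core of nullity `k + 6`** — modulo exactly `Q*(3) = 5`, `Q*(4) = 8`, `Q*(5) = 11`
(induction on `k` with the averaging recursion). -/
theorem ncard_fourCircuits_le_avgBound (k : ℕ) : ∀ (M : Matroid α) [M.Finite],
    (∀ e ∈ M.E, ∃ A ⊆ M.E \ {e}, e ∉ M.closure A ∧ e ∉ M.closure ((M.E \ {e}) \ A)) →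
    M.E.encard = M.eRank + (k + 6) → FourCapSpec capPaper 3 5 → FourCapSpec capPaper 4 8 →
    FourCapSpec capPaper 5 11 → {C : Set α | M.IsCircuit C ∧ C.ncard = 4}.ncard ≤ avgBound k := by
  induction k with
  | zero =>
    intro M _ hfree hd hQ3 hQ4 hQ5
    exact ncard_fourCircuits_le_forty_nine M hfree hd hQ3 hQ4 hQ5
  | succ k ih =>
    intro M _ hfree hd hQ3 hQ4 hQ5
    have hd' : M.E.encard = M.eRank + ((k + 6) + 1) := by
      rw [hd]; congr 1
    have h := ncard_fourCircuits_sub_div_le M hfree (d := k + 6) hd' (by omega)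
      (fun M' _ hfree' hd'' => ih M' hfree' hd'' hQ3 hQ4 hQ5)
    have h' := le_mul_div_of_sub_div_le (m := k + 6 + 6) (by omega) h
    simp only [avgBound]
    have e1 : k + 6 + 6 = k + 12 := by ring
    have e2 : k + 6 + 6 - 4 = k + 8 := by omega
    rw [e1, e2] at h'
    exact h'

/-- The first values of the averaging table. -/
theorem avgBound_values : avgBound 1 = 73 ∧ avgBound 2 = 105 ∧ avgBound 3 = 147 ∧ avgBound 4 = 200 ∧
    avgBound 5 = 266 ∧ avgBound 6 = 347 ∧ avgBound 18 = 3445 ∧ avgBound 22 = 5933 := by decide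


end S1

end PercRepro
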